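import Summits.SmoothPoincare4.SmoothPoincare4.Theses.CongruenceShadows
import Summits.SmoothPoincare4.SmoothPoincare4.Theses.GroupTrisection
import Literature.Topology.FourManifolds.TrisectionFunctorSPC4
import Literature.Topology.FourManifolds.TrisectionEulerProofs
import Literature.Topology.FourManifolds.TrisectionFunctorGKVanKampen
import Literature.Topology.FourManifolds.FlowerMelon
import Literature.Topology.FourManifolds.TrisectionsProofs
import Literature.Topology.FourManifolds.TrisectionsBalancing
import Literature.Topology.FourManifolds.GroupTrisectionsConnectSum
import Literature.Topology.FourManifolds.SPC4Handles
import Literature.Topology.FourManifolds.LickorishWallace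
import Literature.Topology.FourManifolds.TrisectionsExistenceUnbalanced
import HarnessLib

/-!
# Level data of line `level-set-kirby-triple` (crux `AgkCor6Sufficiency`, stmt-SmoothPoincare4-10894)

Routes `CongruenceShadows` / `GroupTrisection`, crux `…Theses.CongruenceShadows.AgkCor6Sufficiency`
(Abrams–Gay–Kirby Cor. 6 ⇐), line `level-set-kirby-triple` (checked skeleton
`Cruxes/AgkCor6Sufficiency/Lines/level-set-kirby-triple.lean`).  This file carries, verbatim from
the skeleton, the line's central VOCABULARY — the *level datum* `LevelDatum M g κ` (a bundle of
EXISTING tree objects: the Gay–Kirby Lemma-14 data `BiCollar` / `TriData` whose sectors form an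
`IsGKTrisection`, plus the Morse bookkeeping of the construction's Morse function relative to its
top level), its Kirby triple `LevelDatum.kernels` (`groupGKTrisectionOf`), its `2`-handlebody
`LevelDatum.TwoHandlebody` (`RegularSublevel`), the statement `LevelDatumExists` — and PROVES the
registered stub `stub_levelDatum_exists : LevelDatumExists` (E₀) by carrying out once more the
construction of the tree's sorry-free `Literature.Topology.FourManifolds.exists_isGKTrisection`
(Gay–Kirby 2016, Thm. 4 via §4, Lemma 14; arXiv:1205.1565 [GayKirby2016]), keeping the data
that theorem forgets behind `∃ S`.  No new geometry, no named fact, no `sorry`.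
-/

noncomputable section

-- the prescribed namespace `Summit.<P>.<Sub>.…` duplicates `SmoothPoincare4` (P = Sub)
set_option linter.dupNamespace false

open Set Function Filter Metric
open scoped Manifold ContDiff ContinuousMap Topology

namespace Summit.SmoothPoincare4.SmoothPoincare4.Cruxes.AgkCor6Sufficiency.LevelSetKirbyTriple

open Literature.Topology.FourManifolds

/-! ## The level datum (bundle of existing tree declarations, no new geometry) -/

/-- **Level datum of type `(g; κ)` on a closed smooth `4`-manifold `M`**: the tree's
Gay–Kirby Lemma-14 data (`BiCollar`, `TriData`) whose sectors form a `(g; κ 0, κ 1, κ 2)`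
Gay–Kirby trisection, plus the Morse bookkeeping of `f = B.f` relative to the top level
`c = T.c`: below `c` all critical points have index `≤ 2` (so `{f ≤ c}` is the `2`-handlebody),
above `c` there are exactly one critical point of index `4`, `κ 2` of index `3` and none of index
`≤ 2` (so `{f ≥ c} ≅ ♮^{κ 2} S¹ × B³` is the `3`- and `4`-handles).  Markings of the central
surface are NOT part of the datum. -/
structure LevelDatum (M : Type) [TopologicalSpace M] [T2Space M] [SecondCountableTopology M]
    [CompactSpace M] [ChartedSpace (EuclideanSpace ℝ (Fin 4)) M] [IsManifold (𝓡 4) ∞ M]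
    (g : ℕ) (κ : Fin 3 → ℕ) where
  /-- The bi-collar: Morse function `f`, regular level `a`, unit field `U`, Heegaard function `g`
  of the level, its regular value `b`, unit field `V`. -/
  B : BiCollar M
  /-- The sector data over `B`: Morse frame, bevel of the first sector, top level `c`, rounding
  width `ε`. -/
  T : B.TriData
  /-- The three sectors `![X₁, X₂, X₃]` of the construction are a `(g; κ)` Gay–Kirby trisection. -/
  isGKTrisection : IsGKTrisection M g κ T.sectors
  /-- Below the top level every critical point of `f` has index `≤ 2`. -/
  morseIndex_le_two_of_lt_top :
    ∀ p, IsMCriticalPt (𝓡 4) B.f p → B.f p < T.c → morseIndex (𝓡 4) B.f p ≤ 2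
  /-- Above the top level there is no critical point of index `≤ 2`. -/
  ncard_top_of_le_two :
    ∀ i, i ≤ 2 → (criticalSetOfIndex (𝓡 4) B.f i ∩ B.f ⁻¹' Set.Ioi T.c).ncard = 0
  /-- Above the top level there are exactly `κ 2` critical points of index `3`. -/
  ncard_top_three : (criticalSetOfIndex (𝓡 4) B.f 3 ∩ B.f ⁻¹' Set.Ioi T.c).ncard = κ 2
  /-- Above the top level there is exactly one critical point of index `4`. -/
  ncard_top_four : (criticalSetOfIndex (𝓡 4) B.f 4 ∩ B.f ⁻¹' Set.Ioi T.c).ncard = 1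

namespace LevelDatum

variable {M : Type} [TopologicalSpace M] [T2Space M] [SecondCountableTopology M]
  [CompactSpace M] [ChartedSpace (EuclideanSpace ℝ (Fin 4)) M] [IsManifold (𝓡 4) ∞ M]
  {g : ℕ} {κ : Fin 3 → ℕ}

/-- **The Kirby triple of a level datum** read through a based marking `(x₀, μ)` of the central
surface: Abrams–Gay–Kirby's `𝒢` of the construction's trisection (`groupGKTrisectionOf`). -/
def kernels (d : LevelDatum M g κ) (x₀ : centralSurface d.T.sectors)
    (μ : SurfaceGroup g ≃* FundamentalGroup (centralSurface d.T.sectors) x₀) :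
    TrisectionKernels g :=
  groupGKTrisectionOf d.isGKTrisection x₀ μ

/-- Unfolding of `kernels`. -/
theorem kernels_eq (d : LevelDatum M g κ) (x₀ : centralSurface d.T.sectors)
    (μ : SurfaceGroup g ≃* FundamentalGroup (centralSurface d.T.sectors) x₀) :
    d.kernels x₀ μ = groupGKTrisectionOf d.isGKTrisection x₀ μ := rfl

/-- Re-marking: any kernel triple isomorphic to the Kirby triple of a level datum IS its Kirby
triple for another marking at the same base point (`exists_marking_groupGKTrisectionOf_eq`). -/
theorem exists_marking_eq (d : LevelDatum M g κ) (x₀ : centralSurface d.T.sectors)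
    (μ : SurfaceGroup g ≃* FundamentalGroup (centralSurface d.T.sectors) x₀)
    {K : TrisectionKernels g} (h : TrisectionKernels.Iso (d.kernels x₀ μ) K) :
    ∃ μ' : SurfaceGroup g ≃* FundamentalGroup (centralSurface d.T.sectors) x₀, d.kernels x₀ μ' = K :=
  exists_marking_groupGKTrisectionOf_eq d.isGKTrisection x₀ μ h

/-- The top level `c` is a regular level of `f` (no critical point on it, `T.regular_c`). -/
theorem regularTop (d : LevelDatum M g κ) : IsRegularLevel (𝓡 4) d.B.f d.T.c :=
  ⟨d.T.Fr.isMorse.contMDiff, fun _ _ => BoundarylessManifold.isInteriorPoint,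
    fun x hx => d.T.regular_c x hx⟩

/-- **The `2`-handlebody `{f ≤ c}` of a level datum**, a compact smooth `4`-manifold with
boundary the level `f⁻¹(c)` (`RegularSublevel`). -/
abbrev TwoHandlebody (d : LevelDatum M g κ) : Type := RegularSublevel d.regularTop

/-- The level structure at the top: the superlevel set `{f ≥ c}` (the `3`- and `4`-handles) lies
in the third sector, by the very definition `X₃ = closure S₃ ∪ {f ≥ c}` of the construction. -/
theorem superlevel_subset_sectors_two (d : LevelDatum M g κ) :
    {x | d.T.c ≤ d.B.f x} ⊆ d.T.sectors 2 := by
  intro x hx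
  rw [BiCollar.TriData.sectors_two]
  exact Set.mem_union_right _ hx

end LevelDatum

/-! ## The statement of stub (E₀) -/

/-- **(E₀) Level data exist** (Gay–Kirby 2016, Thm. 4 via §4, Lemma 14, in the form the tree's
construction `exists_isGKTrisection` actually produces before forgetting the data): every closed
connected smooth `4`-manifold carries a level datum of some type `(g; κ)`. -/
def LevelDatumExists : Prop :=
  ∀ (M : Type) [TopologicalSpace M] [T2Space M] [SecondCountableTopology M] [CompactSpace M]
    [ChartedSpace (EuclideanSpace ℝ (Fin 4)) M] [IsManifold (𝓡 4) ∞ M] [ConnectedSpace M],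
    ∃ (g : ℕ) (κ : Fin 3 → ℕ), Nonempty (LevelDatum M g κ)

/-! ## Stub (E₀): level data exist (the construction of `exists_isGKTrisection`, data kept) -/

/-- **(E₀) Level data exist**: every closed connected smooth `4`-manifold `M` carries a level
datum of some type `(g; k₁, k₂, k₁)` — the Gay–Kirby Lemma-14 data (`BiCollar.shrunk`,
`BiCollar.TriData.ofLevels`) of the rescaled self-indexing Morse function of
`exists_isMorse_apply_eq_three_mul_index` (critical values `3 · index`, top level `c = 6 + η / 4`,
`0 < η ≤ 1 / 16`), assembled by `TubeFrame.exists_isGKTrisection_of_params`: the proof of the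
tree's `exists_isGKTrisection` (Gay–Kirby 2016, Thm. 4 via §4, Lemma 14), its data kept. -/
theorem stub_levelDatum_exists : LevelDatumExists := by
  intro M _ _ _ _ _ _ _
  classical
  -- (1) the Morse function
  obtain ⟨F, hFM, hFval, hF0, hF4, hF13⟩ := exists_isMorse_apply_eq_three_mul_index M
  set k₁ : ℕ := (criticalSetOfIndex (𝓡 4) F 1).ncard with hk₁
  -- (2) a gradient-like field and the frame data at the critical value `6`
  obtain ⟨ζ, hζgl⟩ := hFM.exists_isGradientLike (fun p _ => BoundarylessManifold.isInteriorPoint)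
  have hv : ∀ q, IsMCriticalPt (𝓡 4) F q → F q = 6 → morseIndex (𝓡 4) F q = 2 := by
    intro q hq h6
    have h := hFval q hq
    have : (morseIndex (𝓡 4) F q : ℝ) = 2 := by rw [h6] at h; linarith
    exact_mod_cast this
  have hsep : ∀ q, IsMCriticalPt (𝓡 4) F q → F q ≠ 6 → 1 ≤ |F q - 6| := by
    intro q hq hne
    have h := hFval q hq
    have hi : morseIndex (𝓡 4) F q ≠ 2 := by intro h2; rw [h2] at h; norm_num at h; exact hne h
    rcases (by omega : morseIndex (𝓡 4) F q ≤ 1 ∨ 3 ≤ morseIndex (𝓡 4) F q) with hle | hge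
    · have : (morseIndex (𝓡 4) F q : ℝ) ≤ 1 := by exact_mod_cast hle
      rw [abs_of_neg (by linarith)]; linarith
    · have : (3 : ℝ) ≤ morseIndex (𝓡 4) F q := by exact_mod_cast hge
      rw [abs_of_pos (by linarith)]; linarith
  obtain ⟨m, R, η₀, hR, hη₀, hframe⟩ := exists_handleBoxes_tubeSystem hFM hζgl hv hsep
  -- (3) the height `η`
  set η : ℝ := min η₀ (min (R ^ 2 / 82) (1 / 16))
  have hηpos : 0 < η := lt_min hη₀ (lt_min (by positivity) (by norm_num))
  have hηR : 82 * η ≤ R ^ 2 := by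
    have : η ≤ R ^ 2 / 82 := (min_le_right _ _).trans (min_le_left _ _); linarith
  have hη16 : η ≤ 1 / 16 := (min_le_right _ _).trans (min_le_right _ _)
  obtain ⟨H, TS, hchart, hcentre, hTSR, -, -⟩ := hframe η hηpos (min_le_left _ _)
  -- (4) the level `a = 6 - η` is regular and connected
  have hcritval : ∀ x, IsMCriticalPt (𝓡 4) F x → F x = 6 - η → False := by
    intro x hx hxa
    have h := hFval x hx
    rcases Nat.lt_or_ge (morseIndex (𝓡 4) F x) 2 with hlt | hge
    · have : (morseIndex (𝓡 4) F x : ℝ) ≤ 1 := by exact_mod_cast Nat.lt_succ_iff.1 hlt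
      linarith
    · have : (2 : ℝ) ≤ morseIndex (𝓡 4) F x := by exact_mod_cast hge
      linarith
  have ha : IsRegularLevel (𝓡 4) F (6 - η) :=
    ⟨hFM.contMDiff, fun x _ => BoundarylessManifold.isInteriorPoint, fun x hx hc => hcritval x hc hx⟩
  haveI : ConnectedSpace (RegularLevel ha) := by
    refine connectedSpace_regularLevel (k := 3) hFM ha ?_ (fun z hz hza => ?_) ?_
    · exact (Set.ncard_eq_one.1 hF0).elim fun x hx => by rw [hx]; exact subsingleton_singleton
    · have h := hFval z hz
      have : (morseIndex (𝓡 4) F z : ℝ) < 2 := by linarith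
      have : morseIndex (𝓡 4) F z < 2 := by exact_mod_cast this
      show morseIndex (𝓡 4) F z + 2 ≤ 3 + 1; omega
    · obtain ⟨x, hx⟩ := Set.ncard_eq_one.1 hF0
      have hxc : x ∈ criticalSetOfIndex (𝓡 4) F 0 := by rw [hx]; exact mem_singleton x
      obtain ⟨hxcrit, hx0⟩ := mem_criticalSetOfIndex.1 hxc
      refine ⟨x, ?_⟩
      have h := hFval x hxcrit
      rw [hx0] at h; norm_num at h; rw [h]; linarith
  -- (5) belt radii and slope bounds, the tube amplitude `εT`
  obtain ⟨Lχ, hLχ0, hLχ⟩ :=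
    exists_abs_deriv_smoothTransition_comp_le (r₀ := η / 16) (r₁ := η / 8) (by linarith)
  obtain ⟨Lχ₂, hLχ₂0, hLχ₂⟩ :=
    exists_abs_deriv_one_sub_smoothTransition_comp_le (r₂ := η / 16) (r₃ := η / 8) (by linarith)
  set εT : ℝ := min (1 / 100) (1 / (32 * η * (Lχ + 1)))
  have hεTpos : 0 < εT := lt_min (by norm_num) (by positivity)
  have hεT1 : εT ≤ 1 / 100 := min_le_left _ _
  have hεTL : εT ≤ 1 / (32 * η * (Lχ + 1)) := min_le_right _ _
  -- (6) the Heegaard data, of genus `max gen₀ (k₁ + m)`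
  obtain ⟨gen₀, hdata⟩ := exists_heegaardData_add TS ha (by rw [hTSR]; exact hηR) hεTpos hεT1
  obtain ⟨φ, b, hb, hφM, hΓφ, hbhalf, -, hbelow, -, hφtube, hH₁₂, hH₃₁, hgen, hlevel, -, -⟩ :=
    hdata (k₁ + m - gen₀)
  obtain ⟨γ, hγ, hγle⟩ := exists_gap_of_criticalValues hφM b
  -- (7) the unit fields and the bi-collar
  obtain ⟨U₁, ρU, hρUs, hρUpos, hUeq, hUgl⟩ := exists_levelUnitField_smul hFM ζ.contMDiff hζgl ha
  set δ' : ℝ := min U₁.δ (η / 32)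
  have hδ'pos : 0 < δ' := lt_min U₁.δ_pos (by positivity)
  have hδ'le : δ' ≤ U₁.δ := min_le_left _ _
  have hδ'η : δ' ≤ η / 32 := min_le_right _ _
  set U : LevelUnitField 3 F (6 - η) := U₁.shrink δ' hδ'pos hδ'le
  obtain ⟨V⟩ := hb.exists_levelUnitField
  haveI : Nonempty (RegularLevel hb) := by obtain ⟨y, hy⟩ := hlevel.nonempty; exact ⟨⟨y, hy⟩⟩
  set B₀ : BiCollar M := ⟨F, 6 - η, ha, U, φ, b, hb, V, inferInstance⟩
  have hFr₀ : B₀.MorseFrame := ⟨hFM, hUgl⟩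
  -- (8) the levels `a < c`, the `TriData`
  set ν : ℝ := Real.sqrt η / 2 with hνdef
  have hνpos : 0 < ν := by rw [hνdef]; have := Real.sqrt_pos.2 hηpos; positivity
  have hν2 : ν ^ 2 = η / 4 := by rw [hνdef, div_pow, Real.sq_sqrt hηpos.le]; norm_num
  set c : ℝ := (6 - η) + η + ν ^ 2 with hcdef
  have hac : B₀.a < c := by show 6 - η < (6 - η) + η + ν ^ 2; rw [hν2]; linarith only [hηpos]
  have hcval : c = 6 + η / 4 := by rw [hcdef, hν2]; ring
  -- the level structure of the critical values `3 · index` around `a = 6 - η` and `c = 6 + η/4`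
  have hbelow_iff : ∀ x, IsMCriticalPt (𝓡 4) F x → (F x < 6 - η ↔ morseIndex (𝓡 4) F x ≤ 1) := by
    intro x hx
    have h := hFval x hx
    constructor
    · intro hlt
      by_contra hgt; push Not at hgt
      have h' : (2 : ℝ) ≤ morseIndex (𝓡 4) F x := by exact_mod_cast hgt
      linarith only [h, h', hlt, hηpos]
    · intro hle
      have h' : (morseIndex (𝓡 4) F x : ℝ) ≤ 1 := by exact_mod_cast hle
      linarith only [h, h', hη16]
  have habove_iff : ∀ x, IsMCriticalPt (𝓡 4) F x → (c < F x ↔ 3 ≤ morseIndex (𝓡 4) F x) := by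
    intro x hx
    have h := hFval x hx
    rw [hcval]
    constructor
    · intro hlt
      by_contra hle; push Not at hle
      have h' : (morseIndex (𝓡 4) F x : ℝ) ≤ 2 := by exact_mod_cast Nat.lt_succ_iff.1 hle
      linarith only [h, h', hlt, hηpos]
    · intro hge
      have h' : (3 : ℝ) ≤ morseIndex (𝓡 4) F x := by exact_mod_cast hge
      linarith only [h, h', hη16]
  have hgapF : ∀ q, IsMCriticalPt (𝓡 4) F q → F q ≤ c ∨ c + 5 / 2 < F q := by
    intro q hq
    rcases Nat.lt_or_ge (morseIndex (𝓡 4) F q) 3 with hlt | hge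
    · exact Or.inl (not_lt.1 fun h => absurd ((habove_iff q hq).1 h) (by omega))
    · right
      have h := hFval q hq
      have h' : (3 : ℝ) ≤ morseIndex (𝓡 4) F q := by exact_mod_cast hge
      rw [hcval]; linarith only [h, h', hη16]
  have hreg : ∀ x, B₀.f x = c → ¬ IsMCriticalPt (𝓡 4) B₀.f x := by
    intro x hxc hx
    have h := hFval x hx
    change F x = c at hxc
    rw [hxc, hcval] at h
    rcases Nat.lt_or_ge (morseIndex (𝓡 4) F x) 3 with hlt | hge
    · have h' : (morseIndex (𝓡 4) F x : ℝ) ≤ 2 := by exact_mod_cast Nat.lt_succ_iff.1 hlt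
      linarith only [h, h', hηpos]
    · have h' : (3 : ℝ) ≤ morseIndex (𝓡 4) F x := by exact_mod_cast hge
      linarith only [h, h', hη16]
  set ηoL : ℝ := min (9 / 56) γ
  have hηoL : 0 < ηoL := lt_min (by norm_num) hγ
  have hgw : (0 : ℝ) < 2 := two_pos
  -- handle counts of `F` below `a` and above `c`
  have hcount_below : ∀ i, (criticalSetOfIndex (𝓡 4) F i ∩ F ⁻¹' Iio (6 - η)).ncard =
      handleCount 1 k₁ i := by
    intro i
    by_cases hi : i ≤ 1
    · have heq : criticalSetOfIndex (𝓡 4) F i ∩ F ⁻¹' Iio (6 - η) = criticalSetOfIndex (𝓡 4) F i := by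
        refine inter_eq_left.2 fun x hx => ?_
        obtain ⟨hxc, hxi⟩ := mem_criticalSetOfIndex.1 hx
        exact (hbelow_iff x hxc).2 (hxi ▸ hi)
      rw [heq]
      interval_cases i
      · simpa [handleCount] using hF0
      · simp [handleCount, hk₁]
    · have heq : criticalSetOfIndex (𝓡 4) F i ∩ F ⁻¹' Iio (6 - η) = ∅ := by
        refine Set.eq_empty_of_forall_notMem fun x hx => ?_
        obtain ⟨hxc, hxi⟩ := mem_criticalSetOfIndex.1 hx.1
        have := (hbelow_iff x hxc).1 hx.2
        omega
      rw [heq, ncard_empty]; simp only [handleCount]; rw [if_neg (by omega), if_neg (by omega)]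
  have hcount_above : ∀ i, 3 ≤ i →
      (criticalSetOfIndex (𝓡 4) F i ∩ F ⁻¹' Ioi c).ncard = (criticalSetOfIndex (𝓡 4) F i).ncard := by
    intro i hi
    congr 1
    refine inter_eq_left.2 fun x hx => ?_
    obtain ⟨hxc, hxi⟩ := mem_criticalSetOfIndex.1 hx
    exact (habove_iff x hxc).2 (hxi ▸ hi)
  have hcount_above' : ∀ i, i ≤ 2 → (criticalSetOfIndex (𝓡 4) F i ∩ F ⁻¹' Ioi c).ncard = 0 := by
    intro i hi
    have heq : criticalSetOfIndex (𝓡 4) F i ∩ F ⁻¹' Ioi c = ∅ := by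
      refine Set.eq_empty_of_forall_notMem fun x hx => ?_
      obtain ⟨hxc, hxi⟩ := mem_criticalSetOfIndex.1 hx.1
      have := (habove_iff x hxc).1 hx.2
      omega
    rw [heq, ncard_empty]
  set B : BiCollar M := BiCollar.shrunk B₀ c hac
  set T : B.TriData := BiCollar.TriData.ofLevels hFr₀ hac hreg hηoL hgw
  -- basic identifications (`B.f = F`, `B.g = φ`, `B.b = b` hold by `rfl` as well)
  have hBa : B.a = 6 - η := rfl
  have hTc : T.c = c := rfl
  have hBδ : B.U.δ ≤ δ' := BiCollar.δ₀_le
  have hBδη : B.U.δ ≤ η / 32 := hBδ.trans hδ'η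
  have hBξ : ∀ x, B.U.ξ x = ρU x • ζ x := fun x => hUeq x
  have hTε : T.ε ≤ (c - (6 - η)) / 4 ∧ T.ε ≤ ηoL / 2 ∧ T.ε ≤ 2 / 4 := BiCollar.εOf_le
  have hTε' : T.ε ≤ 5 * η / 16 := by have h := hTε.1; rw [hcval] at h; linarith only [h]
  have hTεγ : T.ε ≤ γ / 2 := by linarith only [hTε.2.1, (min_le_right _ _ : ηoL ≤ γ)]
  have hTεm : T.ε ≤ 9 / 112 := by linarith only [hTε.2.1, (min_le_left _ _ : ηoL ≤ 9 / 56)]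
  -- coordinates of the boxes versus the tube system
  have hext : ∀ j (x : M), (H.box j).chart.extend (𝓡 4) x = (H.box j).chart x := fun j x => by simp
  have hcoord : ∀ j (x : M), TS.centred j x = (H.box j).coord x := fun j x => by
    rw [TubeSystem.centred_apply, hchart, hcentre, MilnorBox.coord, hext, hext]
  have hAB : ∀ j (x : M), H.P j x = ((H.box j).coord x 0 ^ 2 + (H.box j).coord x 1 ^ 2) *
      ((H.box j).coord x 2 ^ 2 + (H.box j).coord x 3 ^ 2) := fun j x => by
    rw [HandleBoxes.P_def, HandleBoxes.A_def, HandleBoxes.B_def, H.k_eq j, sqSumLT_two_apply,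
      sqSumGE_two_apply]
  have htube_le : ∀ j (x : M), TubeModel.tube εT (1 / (4 * η)) η ((H.box j).coord x) ≤
      1 + 1 / (4 * η ^ 2) * H.P j x := by
    intro j x
    have h := (TubeModel.tube_sub_mem_Icc hεTpos.le (1 / (4 * η)) η ((H.box j).coord x)).2
    rw [hAB]
    have : 1 / (4 * η) / η = 1 / (4 * η ^ 2) := by field_simp
    rw [this] at h
    linarith only [h]
  have htube_lt : ∀ j (x : M), H.P j x < η ^ 2 →
      TubeModel.tube εT (1 / (4 * η)) η ((H.box j).coord x) < 5 / 4 := by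
    intro j x hP
    have h := htube_le j x
    have : 1 / (4 * η ^ 2) * H.P j x < 1 / 4 := by
      rw [div_mul_eq_mul_div, one_mul, div_lt_iff₀ (by positivity)]; linarith only [hP]
    linarith only [h, this]
  have hφform : ∀ j (y : B.Y), RegularLevel.incl B.hf y ∈ (H.box j).chart.source →
      TubeModel.tube εT (1 / (4 * η)) η ((H.box j).coord (RegularLevel.incl B.hf y)) < 3 →
      B.g y = 1 / 7 * TubeModel.tube εT (1 / (4 * η)) η ((H.box j).coord (RegularLevel.incl B.hf y)) := by
    intro j y hys hlt
    have hys' : y.1 ∈ (TS.chart j).source := by rw [hchart]; exact hys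
    have h := hφtube j y hys' (by rw [hcoord]; exact hlt)
    rwa [hcoord] at h
  -- (9) the tube frame
  set 𝔉 : T.TubeFrame (Fin m) :=
    { ζ := fun x => ζ x, hζ := ζ.contMDiff, hgl := hζgl, ρU := ρU, continuous_ρU := hρUs.continuous,
      ρU_pos := hρUpos, U_eq := hBξ, η₂ := η, boxes := H, band_le := by linarith only [hBδη, hηpos],
      ν := ν, ν_pos := hνpos, two_nu_sq_le := by rw [hν2]; linarith only [hηpos],
      c_eq := by rw [hTc, hBa],
      kg := 1 / 7, g₀ := 0, εT := εT, κT := 1 / (4 * η), P₀ := η ^ 2, m₀ := 9 / 28,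
      kg_pos := by norm_num, εT_nonneg := hεTpos.le, κT_pos := by positivity, P₀_pos := by positivity,
      P₀_le := le_rfl,
      g_tube := fun j y hys hP => by
        rw [add_zero]; exact hφform j y hys ((htube_lt j _ hP).trans (by norm_num)),
      g_margin := fun j y hys hP => by
        have h' := htube_lt j _ hP
        rw [hφform j y hys (h'.trans (by norm_num))]; change _ ≤ b - 9 / 28; linarith only [h', hbhalf],
      lt_m₀ := by linarith only [hTεm],
      critgap := fun y hy hyb => by
        have h := hγle y hy hyb
        change φ y ≤ b - 2 * T.ε
        linarith only [h, hTεγ] }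
  -- (10) the belt parameters, (11) the middle-sector parameters
  have hεw' : T.D.εw < 9 / 28 := lt_of_le_of_lt (T.D.εw_le_δU.trans hBδη) (by linarith only [hη16])
  obtain ⟨𝔓⟩ := 𝔉.nonempty_beltParams rfl rfl rfl rfl rfl hν2 hεT1 hbhalf hεw' hLχ0 hLχ hLχ₂0 hLχ₂ hεTL
  obtain ⟨Lb, hLb, hκb⟩ := BiCollar.TriData.ofLevels_D_small hFr₀ hac hreg hηoL hgw
  obtain ⟨𝔔⟩ := 𝔉.nonempty_midParams rfl rfl rfl rfl rfl hν2 hεT1 hbhalf hη16 hBδη hTε' hLb hκb hφform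
  -- (12) the hypotheses of the assembly
  have hsurf : IsConnected B.surface := by
    haveI : ConnectedSpace B.F := isConnected_iff_connectedSpace.1 hlevel
    exact isConnected_range ((RegularLevel.isEmbedding_incl B.hf).continuous.comp
      (RegularLevel.isEmbedding_incl B.hg).continuous)
  have hΓ : ∀ x, |B.gFun x| ≤ 1 := fun x => hΓφ (B.lamLift x)
  have hσ : 0 < B.U.δ / 2 := half_pos B.U.δ_pos
  have hgap : ∀ q, IsMCriticalPt (𝓡 4) B.f q → B.f q ≤ T.c ∨ T.c + 1 + T.ε + B.U.δ / 2 < B.f q := by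
    intro q hq
    rcases hgapF q hq with h | h
    · exact Or.inl h
    · exact Or.inr (by change c + 1 + T.ε + B.U.δ / 2 < F q; linarith only [h, hTεm, hBδη, hη16])
  -- (13) assemble the trisection
  obtain ⟨k₂, -, hGK⟩ := 𝔉.exists_isGKTrisection_of_params 𝔓 𝔔 hφM hεTpos hbelow hsurf hgen hH₁₂ hH₃₁
    hcount_below hΓ hσ (le_of_eq (by ring)) hgap
    ((hcount_above 4 (by norm_num)).trans hF4) ((hcount_above 3 le_rfl).trans hF13.symm)
    (fun i hi => hcount_above' i hi)
  -- (14) keep the data: the level datum of type `(gen₀ + (k₁ + m - gen₀); k₁, k₂, k₁)`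
  refine ⟨gen₀ + (k₁ + m - gen₀), ![k₁, k₂, k₁],
    ⟨{ B := B, T := T, isGKTrisection := hGK, morseIndex_le_two_of_lt_top := fun p hp hlt => ?_,
       ncard_top_of_le_two := fun i hi => hcount_above' i hi,
       ncard_top_three := (hcount_above 3 le_rfl).trans hF13.symm,
       ncard_top_four := (hcount_above 4 (by norm_num)).trans hF4 }⟩⟩
  -- below the top level `c` every critical point has index `≤ 2`
  by_contra h3
  exact absurd hlt (not_lt.2 ((habove_iff p hp).2 (not_le.1 h3)).le)

end Summit.SmoothPoincare4.SmoothPoincare4.Cruxes.AgkCor6Sufficiency.LevelSetKirbyTriple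

end
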